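import Literature.LinearAlgebra.Matrix.RegularAdRangeSupCommutant
import HarnessLib

/-!
# For a matrix annihilated by a separable polynomial (a SEMISIMPLE matrix), `M_n(K) = [A, M_n(K)] ⊕ C(A)`:
# the commutator map `ad A = L_A − R_A` is semisimple, so its kernel (the commutant) and its range are complementary

Topic `LinearAlgebra/Matrix`; namespace `Literature.LinearAlgebra.Matrix`. KERNEL mathematics only: theorems, no definition, no named fact, no instance,
no notation, no `sorry`.  Generic linear algebra over a PERFECT field `K`, written for the cell `pub/hodgecm-mathlib` (LEAD F0P3a-plan (g9) WORD T8-38 (1),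
road «N6nsGerm», brick (A′) of `CENSUS-N6nsGerm-S1.A-p16g26.md`): the SEMISIMPLE twin of ★ `RegularAdRangeSupCommutant` (A-p16 (g25), chart-A), whose
hypothesis `A.charpoly.Separable` (REGULAR semisimple) is replaced by «`A` is annihilated by SOME separable polynomial `p`» — e.g. `p = (X − a)(X − u)`, `a ≠ u`,
at the SINGULAR semisimple point `ε = a·1₂ ⊕ u` of Harish-Chandra descent (Rogawski 1990 Prop. 8.2.1, Langlands–Shelstad 1990 Thm. 2.3.A), where `χ_ε = (X − a)²(X − u)`
is NOT separable but the minimal polynomial is.  The mechanism is chart-A's own (Borel I.4): `p(L_A) = L_{p(A)} = 0` and `p(R_A) = R_{p(A)} = 0` with `p`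
square-free make `L_A`, `R_A` semisimple (Mathlib `Module.End.isSemisimple_of_squarefree_aeval_eq_zero`), they commute, so over a perfect field `ad A = L_A − R_A` is
semisimple (Mathlib `Module.End.IsSemisimple.sub_of_commute`), and a semisimple endomorphism has `ker ⊕ range = V` (★ chart-A `Module.End.IsSemisimple.isCompl_ker_range`).

* §1 `isSemisimple_mulLeft_of_separable_aeval_eq_zero`, `isSemisimple_mulRight_of_separable_aeval_eq_zero`,
  **`isSemisimple_mulLeft_sub_mulRight_of_separable_aeval_eq_zero`** (`[PerfectField K]`).
* §2 **`isCompl_ker_range_mulLeft_sub_mulRight_of_separable_aeval_eq_zero`** (`M_n(K) = C(A) ⊕ [A, M_n(K)]`), and the two readings the slice chart at a semisimple point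
  consumes: `exists_commute_add_commutator_eq_of_separable_aeval_eq_zero` (`∀ Z, ∃ X Y, Y A = A Y ∧ Z = (A X − X A) + Y` — surjectivity of the differential
  `(X, Y) ↦ [A, X] + Y` of `(g, m) ↦ g m g⁻¹ : GL_n × Z(A) → GL_n` at `(1, A)`), `commutator_eq_zero_of_commutator_commutator_eq_zero_of_separable_aeval_eq_zero`
  (`ker (ad A)² = ker (ad A)`).
* §3 the two standard suppliers of `p`: `isCompl_ker_range_mulLeft_sub_mulRight_of_separable_minpoly` (`p = minpoly K A`) and the singular semisimple point of
  the road `isCompl_ker_range_mulLeft_sub_mulRight_of_mul_sub_eq_zero` (`(A − a)(A − u) = 0`, `a ≠ u`); the regular case `p = χ_A` is ★ chart-A itself.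

HONEST SCOPE. Linear algebra only. HC_CM is proved only modulo the printed citations until rung 0 closes; this file discharges no printed statement (it is the
differential-surjectivity input of the descent chart at a singular semisimple point, road «N6nsGerm» (S1)∕(S2)).

## References
* [Borel1991] A. Borel, *Linear Algebraic Groups*, 2nd ed., GTM 126 (1991), I.4 (4.2: semisimple endomorphisms; 4.4: Jordan decomposition; `Ad s` semisimple for
  semisimple `s`), III.9.1 (the differential of the conjugation map; centralisers of semisimple elements).
* [HornJohnson2013] R. A. Horn, C. R. Johnson, *Matrix Analysis*, 2nd ed. (2013), §4.4 (the operator `X ↦ AX − XB`).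
* [Rogawski1990] J. D. Rogawski, *Automorphic Representations of Unitary Groups in Three Variables* (1990), §8.2 Prop. 8.2.1 p. 112 (descent at `γ₀` singular semisimple).
-/

set_option autoImplicit false

open Polynomial Module

namespace Literature.LinearAlgebra.Matrix

variable {K : Type*} [Field K] {n : Type*} [Fintype n] [DecidableEq n]

/-! ### 1. `L_A`, `R_A`, `ad A` are semisimple when `A` is annihilated by a separable polynomial -/

/-- **`L_A` is semisimple when `p(A) = 0` for a separable `p`**: `p(L_A) X = p(A) X = 0` with `p` square-free (Mathlib
`Module.End.isSemisimple_of_squarefree_aeval_eq_zero`, ★ `aeval_mulLeft_apply`). [cite: Borel1991, I.4 (4.2, 4.4)] -/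
theorem isSemisimple_mulLeft_of_separable_aeval_eq_zero (A : Matrix n n K) {p : K[X]} (hp : p.Separable) (hpA : aeval A p = 0) :
    Module.End.IsSemisimple (LinearMap.mulLeft K A : Module.End K (Matrix n n K)) := by
  refine Module.End.isSemisimple_of_squarefree_aeval_eq_zero hp.squarefree (LinearMap.ext fun X => ?_)
  rw [aeval_mulLeft_apply, hpA, zero_mul, LinearMap.zero_apply]

/-- **`R_A` is semisimple when `p(A) = 0` for a separable `p`** (`p(R_A) X = X p(A) = 0`, ★ `aeval_mulRight_apply`). [cite: Borel1991, I.4 (4.2, 4.4)] -/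
theorem isSemisimple_mulRight_of_separable_aeval_eq_zero (A : Matrix n n K) {p : K[X]} (hp : p.Separable) (hpA : aeval A p = 0) :
    Module.End.IsSemisimple (LinearMap.mulRight K A : Module.End K (Matrix n n K)) := by
  refine Module.End.isSemisimple_of_squarefree_aeval_eq_zero hp.squarefree (LinearMap.ext fun X => ?_)
  rw [aeval_mulRight_apply, hpA, mul_zero, LinearMap.zero_apply]

/-- **`ad A = L_A − R_A` is semisimple when `p(A) = 0` for a separable `p`** (`K` perfect): `L_A`, `R_A` commute and are semisimple; Mathlib
`Module.End.IsSemisimple.sub_of_commute` («`Ad s` is semisimple for semisimple `s`»). [cite: Borel1991, I.4 (4.2, 4.4)] -/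
theorem isSemisimple_mulLeft_sub_mulRight_of_separable_aeval_eq_zero [PerfectField K] (A : Matrix n n K) {p : K[X]} (hp : p.Separable)
    (hpA : aeval A p = 0) :
    Module.End.IsSemisimple (LinearMap.mulLeft K A - LinearMap.mulRight K A : Module.End K (Matrix n n K)) :=
  Module.End.IsSemisimple.sub_of_commute (LinearMap.commute_mulLeft_right A A)
    (isSemisimple_mulLeft_of_separable_aeval_eq_zero A hp hpA) (isSemisimple_mulRight_of_separable_aeval_eq_zero A hp hpA)

/-! ### 2. `M_n(K) = range (ad A) ⊕ C(A)` at a semisimple `A`, and its two readings -/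

/-- **`M_n(K) = [A, M_n(K)] ⊕ C(A)` for `A` annihilated by a separable polynomial** over a perfect field: the commutant `C(A) = ker (ad A)` and the commutators
`range (ad A)` are complementary (★ `Module.End.IsSemisimple.isCompl_ker_range`). [cite: Borel1991, I.4 (4.2, 4.4); III.9.1] -/
theorem isCompl_ker_range_mulLeft_sub_mulRight_of_separable_aeval_eq_zero [PerfectField K] (A : Matrix n n K) {p : K[X]} (hp : p.Separable)
    (hpA : aeval A p = 0) :
    IsCompl (LinearMap.ker (LinearMap.mulLeft K A - LinearMap.mulRight K A : Module.End K (Matrix n n K)))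
      (LinearMap.range (LinearMap.mulLeft K A - LinearMap.mulRight K A : Module.End K (Matrix n n K))) :=
  (isSemisimple_mulLeft_sub_mulRight_of_separable_aeval_eq_zero A hp hpA).isCompl_ker_range

/-- **Every matrix is a commutator with `A` plus an element of the commutant of `A`** (`A` annihilated by a separable polynomial, `K` perfect):
`∀ Z, ∃ X Y, Y A = A Y ∧ Z = (A X − X A) + Y` — surjectivity of `(X, Y) ↦ [A, X] + Y : M_n(K) × C(A) → M_n(K)`, the differential at `(1, A)` of
`(g, m) ↦ g m g⁻¹ : GL_n × Z(A) → GL_n` (the submersivity behind the slice chart at a semisimple point). [cite: Borel1991, I.4 (4.2, 4.4); III.9.1] [cite: HornJohnson2013, §4.4] -/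
theorem exists_commute_add_commutator_eq_of_separable_aeval_eq_zero [PerfectField K] (A : Matrix n n K) {p : K[X]} (hp : p.Separable)
    (hpA : aeval A p = 0) (Z : Matrix n n K) :
    ∃ X Y : Matrix n n K, Y * A = A * Y ∧ Z = (A * X - X * A) + Y := by
  have hZ : Z ∈ LinearMap.ker (LinearMap.mulLeft K A - LinearMap.mulRight K A : Module.End K (Matrix n n K)) ⊔
      LinearMap.range (LinearMap.mulLeft K A - LinearMap.mulRight K A : Module.End K (Matrix n n K)) := by
    rw [(isSemisimple_mulLeft_sub_mulRight_of_separable_aeval_eq_zero A hp hpA).ker_sup_range_eq_top]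
    exact Submodule.mem_top
  obtain ⟨Y, hY, W, hW, hYW⟩ := Submodule.mem_sup.mp hZ
  obtain ⟨X, rfl⟩ := LinearMap.mem_range.mp hW
  rw [LinearMap.mem_ker, LinearMap.sub_apply, LinearMap.mulLeft_apply, LinearMap.mulRight_apply, sub_eq_zero] at hY
  refine ⟨X, Y, hY.symm, ?_⟩
  rw [← hYW, add_comm, LinearMap.sub_apply, LinearMap.mulLeft_apply, LinearMap.mulRight_apply]

/-- **`[A, [A, X]] = 0 ⇒ [A, X] = 0`** (`A` annihilated by a separable polynomial, `K` perfect): `ker (ad A)² = ker (ad A)`, since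
`ker (ad A) ∩ range (ad A) = 0` (★ `ker_inf_range_eq_bot_of_isSemisimple`). [cite: Borel1991, I.4 (4.2, 4.4)] [cite: HornJohnson2013, §4.4] -/
theorem commutator_eq_zero_of_commutator_commutator_eq_zero_of_separable_aeval_eq_zero [PerfectField K] (A : Matrix n n K) {p : K[X]}
    (hp : p.Separable) (hpA : aeval A p = 0) (X : Matrix n n K) (h : A * (A * X - X * A) - (A * X - X * A) * A = 0) :
    A * X - X * A = 0 := by
  have h1 : (A * X - X * A) ∈
      LinearMap.ker (LinearMap.mulLeft K A - LinearMap.mulRight K A : Module.End K (Matrix n n K)) := by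
    rw [LinearMap.mem_ker, LinearMap.sub_apply, LinearMap.mulLeft_apply, LinearMap.mulRight_apply]
    exact h
  have h2 : (A * X - X * A) ∈
      LinearMap.range (LinearMap.mulLeft K A - LinearMap.mulRight K A : Module.End K (Matrix n n K)) :=
    ⟨X, by rw [LinearMap.sub_apply, LinearMap.mulLeft_apply, LinearMap.mulRight_apply]⟩
  have hmem := Submodule.mem_inf.mpr ⟨h1, h2⟩
  rw [ker_inf_range_eq_bot_of_isSemisimple (isSemisimple_mulLeft_sub_mulRight_of_separable_aeval_eq_zero A hp hpA),
    Submodule.mem_bot] at hmem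
  exact hmem

/-! ### 3. The two standard suppliers of the separable annihilating polynomial -/

/-- **Separable MINIMAL polynomial ⇒ `M_n(K) = C(A) ⊕ [A, M_n(K)]`** (`p := minpoly K A`, Mathlib `minpoly.aeval`). [cite: Borel1991, I.4 (4.2, 4.4)] -/
theorem isCompl_ker_range_mulLeft_sub_mulRight_of_separable_minpoly [PerfectField K] (A : Matrix n n K) (hA : (minpoly K A).Separable) :
    IsCompl (LinearMap.ker (LinearMap.mulLeft K A - LinearMap.mulRight K A : Module.End K (Matrix n n K)))
      (LinearMap.range (LinearMap.mulLeft K A - LinearMap.mulRight K A : Module.End K (Matrix n n K))) :=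
  isCompl_ker_range_mulLeft_sub_mulRight_of_separable_aeval_eq_zero A hA (minpoly.aeval K A)

/-- **The singular semisimple point of the road: `p = (X − a)(X − u)` with `a ≠ u` is separable**, so every matrix `ε` with `(ε − a)(ε − u) = 0` — e.g. the block scalar
`ε = a·1₂ ⊕ u` — has `M_n(K) = C(ε) ⊕ [ε, M_n(K)]` although `χ_ε = (X − a)²(X − u)` is not separable. [cite: Rogawski1990, §8.2 Prop. 8.2.1 p. 112] [cite: Borel1991, III.9.1] -/
theorem isCompl_ker_range_mulLeft_sub_mulRight_of_mul_sub_eq_zero [PerfectField K] (A : Matrix n n K) {a u : K} (hau : a ≠ u)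
    (hA : (A - algebraMap K (Matrix n n K) a) * (A - algebraMap K (Matrix n n K) u) = 0) :
    IsCompl (LinearMap.ker (LinearMap.mulLeft K A - LinearMap.mulRight K A : Module.End K (Matrix n n K)))
      (LinearMap.range (LinearMap.mulLeft K A - LinearMap.mulRight K A : Module.End K (Matrix n n K))) := by
  have hp : ((X - C a) * (X - C u)).Separable := by
    refine (Polynomial.separable_X_sub_C (x := a)).mul (Polynomial.separable_X_sub_C (x := u)) ?_
    exact Polynomial.isCoprime_X_sub_C_of_isUnit_sub (sub_ne_zero.2 hau).isUnit
  refine isCompl_ker_range_mulLeft_sub_mulRight_of_separable_aeval_eq_zero A hp ?_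
  rw [map_mul, map_sub, map_sub, aeval_X, aeval_C, aeval_C]
  exact hA

end Literature.LinearAlgebra.Matrix
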